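import Summits.ResolutionOfSingularities.ResolutionOfSingularities.Theorems.PurelyInseparableDim4PointStepLocal
import HarnessLib

/-!
# Purely inseparable four-folds: the NEW affine chart at a point of the walk after a point blow-up (brick TY-3j
# part 2 «CHART OF A CHART, POINT CENTRE», cell `res-dim4-pi`)

[OURS · counted 0] (D-0157 DOOR 2; item (c5) of the typ-3 S3 memo for POINT centres; host item
stmt-ResolutionOfSingularities-16155, helper). Nothing here proves resolution of singularities in dimension ≥ 4 /
characteristic `p`.

The induction invariant of the depth-`n` assembly (MODE 0 / ISOLATED regime) is an OPEN-IMMERSION CHART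
`φ : 𝔸⁵_K ⟶ Z`, `φ(ξ) = x₀`, carrying the marked ideal to the model: `M.ideal.comap φ = hypSheaf p s.F`. Part 1
(`…PointStepLocal`) read a point blow-up `π : W → Z` of `x₀` over such a chart (in the `V ≅ 𝔸⁵` dress). This file:

* `isoOpensRange_*`, `comap_comap_isoOpensRange` — the open-immersion chart in the `(V, e)` dress of part 1
  (`V = φ.opensRange`, `e = φ.isoOpensRange⁻¹`);
* `isOpenImmersion_specMap_algEquiv` — `Spec Θ` of a `K`-algebra automorphism is an open immersion (an iso);
* **`exists_chart_step`** — for every chart index `j : Fin 4` and every point `b` of the exceptional hyperplane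
  (`b_j = 0`; `K` perfect): there is an OPEN IMMERSION `φ' : 𝔸⁵_K ⟶ W` (explicitly `Spec Θ ≫ chartImm_j ≫ (π⁻¹V).ι`
  with typ-2's re-centring-and-cleaning automorphism `Θ`) with `π (φ' ξ) = x₀` and
  `(M.transform π 𝓘_{x₀}).ideal.comap φ' = hypSheaf p (CentreBlowup.step p univ j b s).F` — the SAME SHAPE as the input,
  with the walk's next state: the re-entry point of the induction;
* `le_idealOrder_transform_chart_step_iff` — at the new centre `φ' ξ` the transformed ideal has order `≥ p` iff
  `IsEquimultiplePoint p univ j b s` (TY-3 §1 `isEquimultiplePoint_iff_le_ordZero_step` read through `φ'`).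

AI-produced formalisation, weaker than expert review. bears_on: LADDER-RESOLUTION:D157-DOOR2 (res-dim4-pi · TY-3j).
-/

set_option linter.dupNamespace false -- D-0017: single-problem summit path `Summit.<S>.<S>.…` by design

noncomputable section

open MvPolynomial Finset CategoryTheory AlgebraicGeometry Opposite TopologicalSpace

namespace Summit.ResolutionOfSingularities.ResolutionOfSingularities.Theorems.PIDim4

open Literature.AlgebraicGeometry.Resolution
open Literature.AlgebraicGeometry.Resolution.Hauser2010
open Literature.AlgebraicGeometry.Resolution.AffinePointBlowup (P A γ coord Wtop ξ)

namespace Equimultiple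

section OpenChart

variable {K : Type} [Field K] {p : ℕ} [hp : Fact p.Prime] [CharP K p]
variable {Z W : Scheme.{0}} {π : W ⟶ Z} {x₀ : Z}

omit hp [CharP K p] in
/-- `x₀ = φ(ξ)` lies in the range of the chart. [folklore] -/
theorem mem_opensRange_of_eq (φ : P 4 K ⟶ Z) [IsOpenImmersion φ] (hφ : φ (ξ 4 K) = x₀) : x₀ ∈ φ.opensRange :=
  ⟨ξ 4 K, hφ⟩

omit hp [CharP K p] in
/-- The inverse of `φ : 𝔸⁵ ≅ φ(𝔸⁵)` sends `x₀ = φ(ξ)` to the origin. [folklore] -/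
theorem isoOpensRange_inv_apply (φ : P 4 K ⟶ Z) [IsOpenImmersion φ] (hφ : φ (ξ 4 K) = x₀) :
    φ.isoOpensRange.symm.hom.base ⟨x₀, mem_opensRange_of_eq φ hφ⟩ = ξ 4 K := by
  apply φ.isOpenEmbedding.injective
  have h := congrArg (fun f => f.base (⟨x₀, mem_opensRange_of_eq φ hφ⟩ : φ.opensRange))
    (Scheme.Hom.isoOpensRange_inv_comp φ)
  simp only [Iso.symm_hom, Scheme.Hom.comp_base, TopCat.comp_app] at h ⊢
  rw [h, hφ]
  rfl

omit hp [CharP K p] in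
/-- The chart equation in the `(V, e)` dress: `(M.ideal|_{φ(𝔸⁵)}).comap e⁻¹ = M.ideal.comap φ`. [folklore] -/
theorem comap_comap_isoOpensRange (φ : P 4 K ⟶ Z) [IsOpenImmersion φ] (I : Z.IdealSheafData) :
    (I.comap φ.opensRange.ι).comap φ.isoOpensRange.symm.inv = I.comap φ := by
  rw [← Scheme.IdealSheafData.comap_comp, Iso.symm_inv, Scheme.Hom.isoOpensRange_hom_ι]

omit hp [CharP K p] in
/-- `Spec` of a `K`-algebra automorphism of `K[z, x₁, …, x₄]` is an open immersion (an isomorphism) of `𝔸⁵_K`.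
[folklore] -/
theorem isOpenImmersion_specMap_algEquiv (Θ : A 4 K ≃ₐ[K] A 4 K) :
    IsOpenImmersion (Spec.map (CommRingCat.ofHom (Θ : A 4 K →+* A 4 K))) := by
  have : IsIso (CommRingCat.ofHom (Θ : A 4 K →+* A 4 K)) :=
    (inferInstance : IsIso Θ.toRingEquiv.toCommRingCatIso.hom)
  infer_instance

/-- **The re-centred chart point lies over `x₀`.** For the cleaning automorphism `Θ` of typ-2's dictionary
(`Θ xᵢ = xᵢ + bᵢ`) at a point `b` of the exceptional hyperplane (`b_j = 0`), the point
`(π⁻¹V).ι (chartImm_j ((Spec Θ) ξ))` of `W` maps to `x₀` under `π`. [cite: HauserPerlega2019PRIMS, §2] -/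
theorem π_ι_chartImm_specMap_ξ [IsLocallyNoetherian Z] (hx₀ : IsClosed ({x₀} : Set Z)) {V : Z.Opens}
    (hx₀V : x₀ ∈ V) (e : (V : Scheme.{0}) ≅ P 4 K) (hex₀ : e.hom.base ⟨x₀, hx₀V⟩ = ξ 4 K)
    (hπ : IsBlowup π (Scheme.IdealSheafData.vanishingIdeal (⟨{x₀}, hx₀⟩ : Closeds Z))) (j : Fin 4)
    {b : Fin 4 → K} (hbj : b j = 0) (Θ : A 4 K ≃ₐ[K] A 4 K) (hs : ∀ i : Fin 4, Θ (X i.succ) = X i.succ + C (b i)) :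
    π ((π ⁻¹ᵁ V).ι (AffineCoordBlowup.chartImm (isBlowup_chart hx₀ hx₀V e hex₀ hπ)
        (ChartDictionary.succ_mem_centreVars (Finset.mem_univ j))
        ((Spec.map (CommRingCat.ofHom (Θ : A 4 K →+* A 4 K))) (ξ 4 K)))) = x₀ := by
  set y := AffineCoordBlowup.chartImm (isBlowup_chart hx₀ hx₀V e hex₀ hπ)
      (ChartDictionary.succ_mem_centreVars (Finset.mem_univ j))
      ((Spec.map (CommRingCat.ofHom (Θ : A 4 K →+* A 4 K))) (ξ 4 K)) with hy
  -- `x_j ∈ Θ⁻¹(𝔪₀)` because `Θ x_j = x_j + b_j = x_j`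
  have hX : (X j.succ : A 4 K) ∈ ((Spec.map (CommRingCat.ofHom (Θ : A 4 K →+* A 4 K))) (ξ 4 K)).asIdeal := by
    rw [Spec.map_apply, PrimeSpectrum.comap_asIdeal, Ideal.mem_comap, CommRingCat.hom_ofHom]
    have hΘ : (Θ : A 4 K →+* A 4 K) (X j.succ) = X j.succ := by
      rw [show (Θ : A 4 K →+* A 4 K) (X j.succ) = Θ (X j.succ) from rfl, hs j, hbj, C_0, add_zero]
    rw [hΘ]
    exact (mem_originIdeal_iff K (4 + 1)).mpr (constantCoeff_X K j.succ)
  -- hence `πV y` is on the centre `{ξ}`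
  have hmem := (π_chartImm_mem_CΛ_iff (isBlowup_chart hx₀ hx₀V e hex₀ hπ) (Finset.mem_univ j)
    ((Spec.map (CommRingCat.ofHom (Θ : A 4 K →+* A 4 K))) (ξ 4 K))).mpr hX
  rw [← hy, centreVars_univ, AffineCoordBlowup.CΛ_univ] at hmem
  have hξ : e.hom ((π ∣_ V) y) = ξ 4 K := by
    have h : ((π ∣_ V) ≫ e.hom) y = ξ 4 K := hmem
    rwa [Scheme.Hom.comp_apply] at h
  have h1 : (π ∣_ V) y = ⟨x₀, hx₀V⟩ := by
    apply e.hom.isOpenEmbedding.injective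
    rw [hex₀]
    exact hξ
  have h2 : ∀ z : (π ⁻¹ᵁ V : Scheme.{0}), π ((π ⁻¹ᵁ V).ι z) = V.ι ((π ∣_ V) z) := fun z => by
    rw [← Scheme.Hom.comp_apply, ← Scheme.Hom.comp_apply, morphismRestrict_ι]
  rw [h2 y, h1]
  rfl

/-- **CHART OF A CHART (point centre), `(V, e)` dress.** `Z` locally Noetherian, `e : V ≅ 𝔸⁵_K` an affine chart at
the closed point `x₀` (`e x₀ = ξ`) with `(M.ideal|_V).comap e⁻¹ = (z^p + F)·𝒪`, `mult M = p`, `p ≤ ord₀ F`, `π : W → Z` ANY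
blowing up of `x₀`, `K` perfect. For every chart index `j` and every point `b` of the exceptional hyperplane (`b_j = 0`)
the open immersion `φ' = Spec Θ ≫ chartImm_j ≫ (π⁻¹V).ι : 𝔸⁵_K ⟶ W` (typ-2's re-centring-and-cleaning `Θ`) is a chart
at a point over `x₀` on which the transformed marked ideal reads `(z^p + (step p univ j b s).F)·𝒪`.
[cite: HauserPerlega2019PRIMS, §2 (the blowup in the x₁-chart, followed by cleaning)]
[cite: BierstoneGrigorievMilmanWlodarczyk2011, §3.2] -/
theorem exists_chart_step [IsLocallyNoetherian Z] [PerfectRing K p] [DecidableEq K] (hx₀ : IsClosed ({x₀} : Set Z))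
    {V : Z.Opens} (hx₀V : x₀ ∈ V) (e : (V : Scheme.{0}) ≅ P 4 K) (hex₀ : e.hom.base ⟨x₀, hx₀V⟩ = ξ 4 K)
    (M : MarkedIdeal Z) (hmult : M.mult = p) (s : State K) (hM : (M.ideal.comap V.ι).comap e.inv = hypSheaf p s.F)
    (hperm : (p : ℕ∞) ≤ CentreBlowup.ordAlong (Finset.univ : Finset (Fin 4)) s.F)
    (hπ : IsBlowup π (Scheme.IdealSheafData.vanishingIdeal (⟨{x₀}, hx₀⟩ : Closeds Z))) (j : Fin 4)
    {b : Fin 4 → K} (hbj : b j = 0) :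
    ∃ (φ' : P 4 K ⟶ W) (_ : IsOpenImmersion φ'),
      π (φ' (ξ 4 K)) = x₀ ∧
        (M.transform π (Scheme.IdealSheafData.vanishingIdeal (⟨{x₀}, hx₀⟩ : Closeds Z))).ideal.comap φ' =
          hypSheaf p (CentreBlowup.step p Finset.univ j b s).F := by
  have hπV := isBlowup_chart hx₀ hx₀V e hex₀ hπ
  obtain ⟨Θ, h, -, hs, hc⟩ :=
    ChartDictionary.controlledTransform_chart_eq_step p (Finset.mem_univ j) hbj s hperm hπV
  haveI := isOpenImmersion_specMap_algEquiv Θ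
  refine ⟨(Spec.map (CommRingCat.ofHom (Θ : A 4 K →+* A 4 K)) ≫
      AffineCoordBlowup.chartImm hπV (ChartDictionary.succ_mem_centreVars (Finset.mem_univ j))) ≫ (π ⁻¹ᵁ V).ι,
    inferInstance, ?_, ?_⟩
  · rw [Scheme.Hom.comp_apply, Scheme.Hom.comp_apply]
    exact π_ι_chartImm_specMap_ξ hx₀ hx₀V e hex₀ hπ j hbj Θ hs
  · rw [Scheme.IdealSheafData.comap_comp, comap_transform_ideal_restrict hx₀ hx₀V e hex₀ M s hM hπ, hmult]
    exact hc

/-- **CHART OF A CHART, open-immersion dress** — the re-entry shape of the induction: from a chart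
`φ : 𝔸⁵_K ⟶ Z` (`φ ξ = x₀`, `M.ideal.comap φ = (z^p + F)·𝒪`) to a chart `φ' : 𝔸⁵_K ⟶ W` at a point over `x₀` with
`(M.transform π 𝓘_{x₀}).ideal.comap φ' = (z^p + (step p univ j b s).F)·𝒪`, for every `j` and every `b` with `b_j = 0`.
[cite: BierstoneGrigorievMilmanWlodarczyk2011, §3.2 and Lemma 8.0.3 (2)] -/
theorem exists_chart_step' [IsLocallyNoetherian Z] [PerfectRing K p] [DecidableEq K] (φ : P 4 K ⟶ Z)
    [IsOpenImmersion φ] (hx₀ : IsClosed ({x₀} : Set Z)) (hφ : φ (ξ 4 K) = x₀) (M : MarkedIdeal Z)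
    (hmult : M.mult = p) (s : State K) (hM : M.ideal.comap φ = hypSheaf p s.F)
    (hperm : (p : ℕ∞) ≤ CentreBlowup.ordAlong (Finset.univ : Finset (Fin 4)) s.F)
    (hπ : IsBlowup π (Scheme.IdealSheafData.vanishingIdeal (⟨{x₀}, hx₀⟩ : Closeds Z))) (j : Fin 4)
    {b : Fin 4 → K} (hbj : b j = 0) :
    ∃ (φ' : P 4 K ⟶ W) (_ : IsOpenImmersion φ'),
      π (φ' (ξ 4 K)) = x₀ ∧
        (M.transform π (Scheme.IdealSheafData.vanishingIdeal (⟨{x₀}, hx₀⟩ : Closeds Z))).ideal.comap φ' =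
          hypSheaf p (CentreBlowup.step p Finset.univ j b s).F :=
  exists_chart_step hx₀ (mem_opensRange_of_eq φ hφ) φ.isoOpensRange.symm (isoOpensRange_inv_apply φ hφ) M hmult s
    (by rw [comap_comap_isoOpensRange]; exact hM) hperm hπ j hbj

/-- **At the new centre the order is `≥ p` iff the point is equimultiple.** With `φ'` as in `exists_chart_step`
(any open immersion carrying the transformed ideal to `(z^p + (step p univ j b s).F)·𝒪`):
`p ≤ ord_{φ' ξ} (M.transform π 𝓘_{x₀}).ideal ↔ IsEquimultiplePoint p univ j b s` (TY-3 §1 + the translated-order bridge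
at the origin). [cite: Hauser2010, §F (equiconstant points)] -/
theorem le_idealOrder_transform_chart_step_iff [DecidableEq K] (φ' : P 4 K ⟶ W) [IsOpenImmersion φ']
    (I : W.IdealSheafData) (s : State K) (j : Fin 4) (b : Fin 4 → K)
    (hI : I.comap φ' = hypSheaf p (CentreBlowup.step p Finset.univ j b s).F) :
    (p : ℕ∞) ≤ idealOrder I (φ' (ξ 4 K)) ↔ CentreBlowup.IsEquimultiplePoint p Finset.univ j b s := by
  have hcons : (Fin.cons 0 0 : Fin (4 + 1) → K) = 0 := by
    funext i
    exact Fin.cases rfl (fun _ => rfl) i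
  have hξ : (ξ 4 K).asIdeal = MvPolynomial.vanishingIdeal K {(Fin.cons 0 0 : Fin (4 + 1) → K)} := by
    change originIdeal K (4 + 1) = _
    ext g
    rw [mem_originIdeal_iff, MvPolynomial.mem_vanishingIdeal_singleton_iff, hcons, MvPolynomial.aeval_zero]
    exact Iff.rfl
  rw [← idealOrder_comap_of_isOpenImmersion φ' I (ξ 4 K), hI, natCast_le_idealOrder_hypSheaf_iff _ hξ,
    natCast_le_ordZero_translate_hyp_iff, isEquimultiplePoint_iff_le_ordZero_step,
    natCast_le_ordZero_iff_forall_coeff]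
  have htr : PointBlowup.translate (0 : Fin 4 → K) (CentreBlowup.step p Finset.univ j b s).F =
      (CentreBlowup.step p Finset.univ j b s).F := PointBlowup.translate_zero _
  have h0 : coeff 0 (CentreBlowup.step p Finset.univ j b s).F = 0 := by
    change coeff 0 (deletePthPowers p (CentreBlowup.pointTransform p Finset.univ j b s)) = 0
    rw [coeff_deletePthPowers, if_pos (show IsPthPowerExponent p (0 : Fin 4 →₀ ℕ) from fun i hi => by simp at hi)]
  rw [htr, zero_pow hp.out.ne_zero, zero_add, ← coeff_zero_translate, htr]
  constructor
  · rintro ⟨-, hcoef⟩ d hd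
    by_cases hd0 : d = 0
    · rw [hd0, h0]
    · exact hcoef d hd0 hd
  · intro hcoef
    exact ⟨h0, fun d hd0 hd => hcoef d hd⟩

end OpenChart

end Equimultiple

end Summit.ResolutionOfSingularities.ResolutionOfSingularities.Theorems.PIDim4

end
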